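import Literature.AlgebraicGeometry.Frobenioids.PadicKummerGalois
import Literature.NumberTheory.GaloisRepresentations.LocalDualityTwoZeroInputs
import HarnessLib

/-!
# Frobenioids II, Definition 2.2 (ii): `F_N(A) ≅ H²(H, μ_N(A)) ≅ ℤ/Nℤ` at the Galois binding

Mochizuki, *The geometry of Frobenioids II*, Kyushu J. Math. **62** (2008) 401–460, §2, Definition
2.2 (ii) pp. 17–18 and Remark 2.2.1 p. 18 [cite: MochizukiFrdII2008, Def 2.2 (ii) p.18]:
"— so `F_N(A) ≅ H²(H, μ_N(A)) ≅ ℤ/Nℤ` [cf., e.g., [NSW], Chapter 7, Theorem 7.2.6]" and "the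
finiteness of the cohomology modules `H¹(H, μ_N(A))`, `H²(H, μ_N(A))` [cf., e.g., [NSW], Chapter 7,
Theorem 7.2.6]".

`KummerReciprocity.lean` (abc-iut-L1-t7) PROVES the first isomorphism under condition (c)
(`Kummer.fnEquivOfSurjective`) and records the second as the NAMED FACT `Kummer.FNIsCyclic`
("local class field theory — the Brauer group of a `p`-adic field; not asserted"). This file
DISCHARGES it at the Galois-level binding `Def22Context.ofGalois` (`PadicKummerGalois.lean`) of a
non-archimedean local field `K` of characteristic `0`, from the tree's kernel-checked Brauer-group
computation `|H²(Gal(K̄/E), μ_N)| = N`, cyclic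
(`Literature.NumberTheory.GaloisRepresentations.natCard_two_mu_eq`, `isAddCyclic_two_mu`, Serre,
*Corps locaux* XIII §3), under the one hypothesis a parametric `O^□(A)` must carry: a
`G_K`-equivariant identification `μ_N(O^□(A)) ≅ μ_N(K̄)` of the cyclotomic portion with the
roots of unity of `K̄` (`MuModel`; automatic for `O^□(A) = O^⊳_L`, `O^×_L` of a `μ_N`-saturated
object — the Frobenioid half, abc-iut-L1-t4/d10). Contents:
* `MuModel` (+ constructor `MuModel.ofMonoidHom` from a `G_K`-equivariant embedding
  `O^□(A) ↪ K̄` covering `μ_N(K̄)`), `muCoeffIso` — the induced isomorphism of topological `H`-modules between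
  `μ_N(A)` (acted on through `H ↠ H_A ⊆ Gal(L/K)`) and `μ_N(K̄)|_H`;
* `h2Equiv_ofGalois` — `H²(H, μ_N(A)) ≃+ H²(H, μ_N(K̄))`;
* `finite_h2_ofGalois`, `natCard_h2_ofGalois`, `isAddCyclic_h2_ofGalois` — Remark 2.2.1's
  finiteness input and `|H²(H, μ_N(A))| = N`, cyclic (via `H = Gal(K̄/E₀)` for the finite Galois
  `E₀ = K̄^H`, `exists_isGalois_fixingSubgroup_eq`);
* `fnIsCyclic_of_isAddCyclic` (any `X`) and `nonempty_fn_equiv_zmod_ofGalois` —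
  **`Kummer.FNIsCyclic` DISCHARGED at the binding**: for an `(N, H)`-saturated `A` (only (c)'s
  surjectivity `H²(H_A, μ_N(A)) ↠ H²(H, μ_N(A))` is used), `F_N(A) ≃+ ℤ/Nℤ`.
**Note on topologies.** `Def22Context.ofGalois` is reducible, so `(ofGalois …).AutE` unfolds to
`L ≃ₐ[K] L`, on which Mathlib's Krull topology instance competes with the discrete one fixed by
`Def22Context.instTopologicalSpaceAutE` (they agree propositionally, `L/K` being finite, not
definitionally): Galois-specific statements must therefore go through the `Def22Context` /
`PadicKummer` wrappers (`X.qHA`, `IsNHSaturated X N`, `FN X N`), as below, never through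
`Kummer.infl` / `Kummer.IsCohSaturated` / `Kummer.FNIsCyclic` with the instances re-synthesised;
the abstract lemmas `fnIsCyclic_of_isAddCyclic` / `fnIsCyclic_of_isNHSaturated` carry the
`Kummer.FNIsCyclic` form for any `X`.

Only the EXISTENCE of the isomorphism is obtained (as in the named fact and in abc-iut-L4-t4's
`mlf_H2_mu_equiv_zmod`); the CANONICAL invariant map `F_N(A) ⥲ ℤ/Nℤ` of Theorem 2.4 (ii)
(`FNInvariant`) is not singled out here. Nothing here concerns [IUTchIII]; classical local Galois
cohomology. Universe `0` as in `PadicKummerSetting.lean`.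
-/

noncomputable section

namespace Literature.AlgebraicGeometry.Frobenioids

namespace PadicKummer

namespace Def22Context

open Field IntermediateField CategoryTheory
open Literature.NumberTheory.GaloisRepresentations
open Literature.NumberTheory.GaloisRepresentations.LocalWeilDatum
open Literature.NumberTheory.GaloisRepresentations.DiscreteGaloisModule

variable {K : Type} [Field K] (L : IntermediateField K (AlgebraicClosure K)) [Normal K L]
  (O : Type) [CommMonoid O] [MulDistribMulAction (L ≃ₐ[K] L) O] (N : ℕ)

/-- The hypothesis a parametric monoid `O = O^□(A)` must carry for the LCFT pin: a
`G_K`-equivariant identification of its cyclotomic portion `μ_N(A) ⊆ O^×(A)` (Def. 2.1 (i)) with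
the `N`-th roots of unity of `K̄`, `G_K` acting on `μ_N(A)` through `G_K ↠ Gal(L/K) ↷ O^□(A)`.
For `O^□(A) = O^⊳_L` or `O^×_L` (`A_E = Spec L`, Rmk. 2.2.1) with `μ_N(K̄) ⊆ L` this is the
tautological inclusion. [cite: MochizukiFrdII2008, Def 2.2 (ii) p.18] -/
structure MuModel : Type where
  /-- `μ_N(A) ⥲ μ_N(K̄)` -/
  toMulEquiv : Kummer.Mu N O ≃* rootsOfUnity N (AlgebraicClosure K)
  /-- `G_K`-equivariance, `G_K` acting on `μ_N(A)` through `resGal L : G_K ↠ Gal(L/K)` -/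
  map_smul : ∀ (σ : absoluteGaloisGroup K) (ζ : Kummer.Mu N O),
    toMulEquiv (resGal L σ • ζ) = σ • toMulEquiv ζ

namespace MuModel

variable {L O N} (m : MuModel L O N)

/-- The identification on additive carriers: `Additive μ_N(A) ≃+ MuCarrier K N`.
[cite: MochizukiFrdII2008, Def 2.2 (ii) p.18] -/
def toAddEquiv : Additive (Kummer.Mu N O) ≃+ MuCarrier K N :=
  (MulEquiv.toAdditive m.toMulEquiv).trans MuCarrier.toAdditive.symm

/-- The identification as a continuous `ℤ`-linear equivalence of the (discrete) carriers.
[cite: MochizukiFrdII2008, Def 2.2 (ii) p.18] -/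
def toContinuousLinearEquiv : Additive (Kummer.Mu N O) ≃L[ℤ] MuCarrier K N :=
  { m.toAddEquiv.toIntLinearEquiv with
    continuous_toFun := continuous_of_discreteTopology
    continuous_invFun := continuous_of_discreteTopology }

/-- `toContinuousLinearEquiv` on elements. [cite: MochizukiFrdII2008, Def 2.2 (ii) p.18] -/
@[simp] theorem toContinuousLinearEquiv_apply (x : Additive (Kummer.Mu N O)) :
    m.toContinuousLinearEquiv x = MuCarrier.ofRootsOfUnity (m.toMulEquiv x.toMul) := rfl

end MuModel

/-! ### A constructor: `O^□(A)` given inside `K̄` -/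

section OfMonoidHom

variable {L O N}
variable (ι : O →* AlgebraicClosure K) (hι : Function.Injective ι)
  (hsmul : ∀ (σ : absoluteGaloisGroup K) (x : O), ι (resGal L σ • x) = σ • ι x)
  (hsurj : ∀ ζ : rootsOfUnity N (AlgebraicClosure K),
    ∃ u : Oˣ, ι (u : O) = ((ζ : (AlgebraicClosure K)ˣ) : AlgebraicClosure K))

/-- `ι` on powers of units. [cite: MochizukiFrdII2008, Def 2.1 (i) p.16] -/
private theorem ι_units_pow (u : Oˣ) (n : ℕ) : ι ((u ^ n : Oˣ) : O) = ι (u : O) ^ n := by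
  rw [Units.val_pow_eq_pow_val, map_pow]

/-- The map `μ_N(A) → μ_N(K̄)` induced by an embedding `ι : O^□(A) ↪ K̄` (on units, restricted to
the cyclotomic portion). [cite: MochizukiFrdII2008, Def 2.1 (i) p.16] -/
def MuModel.muHomOfMonoidHom : Kummer.Mu N O →* rootsOfUnity N (AlgebraicClosure K) where
  toFun ζ := ⟨Units.map ι ζ.val, by
    rw [mem_rootsOfUnity, ← map_pow]
    have h : ζ.val ^ N = 1 := ζ.val_mem
    rw [h, map_one]⟩
  map_one' := Subtype.ext (by
    change Units.map ι (1 : Kummer.Mu N O).val = 1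
    rw [Kummer.Mu.val_one, map_one])
  map_mul' ζ ξ := Subtype.ext (by
    change Units.map ι (ζ * ξ).val = Units.map ι ζ.val * Units.map ι ξ.val
    rw [Kummer.Mu.val_mul, map_mul])

/-- `muHomOfMonoidHom` on underlying elements of `K̄`. [cite: MochizukiFrdII2008, Def 2.1 (i) p.16] -/
@[simp] theorem MuModel.coe_muHomOfMonoidHom (ζ : Kummer.Mu N O) :
    (((MuModel.muHomOfMonoidHom (N := N) ι ζ : rootsOfUnity N (AlgebraicClosure K)) :
      (AlgebraicClosure K)ˣ) : AlgebraicClosure K) = ι (ζ.val : O) := rfl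

include hι in
/-- `muHomOfMonoidHom` is injective for injective `ι`. [cite: MochizukiFrdII2008, Def 2.1 (i) p.16] -/
theorem MuModel.muHomOfMonoidHom_injective :
    Function.Injective (MuModel.muHomOfMonoidHom (N := N) ι) := by
  intro ζ ξ h
  have h' := congrArg (fun z : rootsOfUnity N (AlgebraicClosure K) =>
    ((z : (AlgebraicClosure K)ˣ) : AlgebraicClosure K)) h
  simp only [MuModel.coe_muHomOfMonoidHom] at h'
  exact Kummer.Mu.ext (Units.ext (hι h'))

include hι hsurj in
/-- `muHomOfMonoidHom` is surjective when `ι(O^□(A)) ⊇ μ_N(K̄)` on units ("`A` is `μ_N`-saturated"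
at the binding). [cite: MochizukiFrdII2008, Def 2.1 (i) p.16] -/
theorem MuModel.muHomOfMonoidHom_surjective :
    Function.Surjective (MuModel.muHomOfMonoidHom (N := N) ι) := by
  intro ζ
  obtain ⟨u, hu⟩ := hsurj ζ
  have huN : u ^ N = 1 := by
    apply Units.ext
    apply hι
    rw [ι_units_pow, hu, Units.val_one, map_one, ← Units.val_pow_eq_pow_val,
      (mem_rootsOfUnity N (ζ : (AlgebraicClosure K)ˣ)).mp ζ.2, Units.val_one]
  refine ⟨Kummer.Mu.mk u ((mem_rootsOfUnity N u).mpr huN), Subtype.ext (Units.ext ?_)⟩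
  rw [MuModel.coe_muHomOfMonoidHom, Kummer.Mu.val_mk, hu]

/-- **Constructor** for `MuModel` from a `G_K`-equivariant embedding `ι : O^□(A) ↪ K̄` whose image
contains `μ_N(K̄)` on units — the situation of Remark 2.2.1 ("`A_E = Spec(L)` … `H_A` acts
naturally on `L`, `O^□(A)`", with `O^□(A) = O^□_L ⊆ L ⊆ K̄` and `A` `μ_N`-saturated).
[cite: MochizukiFrdII2008, Rmk 2.2.1 p.18] -/
def MuModel.ofMonoidHom : MuModel L O N where
  toMulEquiv := MulEquiv.ofBijective (MuModel.muHomOfMonoidHom (N := N) ι)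
    ⟨MuModel.muHomOfMonoidHom_injective ι hι, MuModel.muHomOfMonoidHom_surjective ι hι hsurj⟩
  map_smul σ ζ := by
    apply Subtype.ext
    apply Units.ext
    change ι ((resGal L σ • ζ).val : O) = ((σ • (MuModel.muHomOfMonoidHom (N := N) ι ζ :
      rootsOfUnity N (AlgebraicClosure K)) : (AlgebraicClosure K)ˣ) : AlgebraicClosure K)
    rw [Units.coe_smul, MuModel.coe_muHomOfMonoidHom, Kummer.Mu.val_smul, Kummer.coe_unitsAct,
      hsmul]

end OfMonoidHom

/-! ### The coefficient isomorphism over `H` and the cohomology of `μ_N(A)` -/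

variable [FiniteDimensional K L]
  (H : Subgroup (absoluteGaloisGroup K)) [H.Normal] (hH : IsOpen (H : Set (absoluteGaloisGroup K)))
  {AutC : Type} [Group AutC] [IsCancelMul O] [MulDistribMulAction AutC O]
  (res : AutC →* (L ≃ₐ[K] L)) (res_smul : ∀ (α : AutC) (x : O), res α • x = α • x)
variable {N} (m : MuModel L O N)

/-- The isomorphism of topological `H`-modules between `μ_N(A)`, on which `H` acts through
`H ↠ H_A ⊆ Gal(L/K)` (the coefficient module of Def. 2.2 (ii)(c), `Kummer.muTopRep` restricted
along `qHA`), and `μ_N(K̄)` restricted to `H ≤ G_K` (the tree's `DiscreteGaloisModule.mu`).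
[cite: MochizukiFrdII2008, Def 2.2 (ii) p.18] -/
def muCoeffIso :
    TopRep.res ((ofGalois L H hH res res_smul).qHA :
        (ofGalois L H hH res res_smul).H →* (ofGalois L H hH res res_smul).HA)
      (Kummer.muTopRep N O (ofGalois L H hH res res_smul).HA) ≅
    ((mu K N).restrict (subgroupIncl H)).toTopRep :=
  topRepIsoOfEquiv m.toContinuousLinearEquiv fun g x =>
    congrArg MuCarrier.ofRootsOfUnity (m.map_smul (g : absoluteGaloisGroup K) (Additive.toMul x))

/-- **"`F_N(A) ≅ H²(H, μ_N(A))`", coefficients identified**: `Hq(H, μ_N(A)) ≃+ Hq(H, μ_N(K̄))`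
(functoriality of continuous cohomology in the coefficient isomorphism `muCoeffIso`).
[cite: MochizukiFrdII2008, Def 2.2 (ii) p.18] -/
def cohomologyEquiv_ofGalois (q : ℕ) :
    continuousCohomology q
        (TopRep.res ((ofGalois L H hH res res_smul).qHA :
            (ofGalois L H hH res res_smul).H →* (ofGalois L H hH res res_smul).HA)
          (Kummer.muTopRep N O (ofGalois L H hH res res_smul).HA)) ≃+
      continuousCohomology q ((mu K N).restrict (subgroupIncl H)).toTopRep :=
  AddEquiv.mk' (continuousCohomologyEquivOfIso (muCoeffIso L O H hH res res_smul m) q) fun x y =>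
    map_add (cohomologyMap (muCoeffIso L O H hH res res_smul m).hom q).hom x y

/-! ### Open normal subgroups of `G_K` are `Gal(K̄/E₀)` -/

include hH in
/-- Every open normal subgroup `H ⊆ G_K` is `Gal(K̄/E₀)` for a (unique) finite Galois extension
`E₀ ⊆ K̄` of `K` — the field "`K̄^H`" (the tree's `exists_isGalois_fixingSubgroup_eq`, Krull
topology). [cite: MochizukiFrdII2008, Def 2.2 (i) p.17] -/
theorem exists_galFixing_eq :
    ∃ E₀ : IntermediateField K (AlgebraicClosure K),
      FiniteDimensional K E₀ ∧ IsGalois K E₀ ∧ galFixing K E₀ = H := by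
  obtain ⟨E₀, h1, h2, h3⟩ :=
    @Literature.NumberTheory.GaloisRepresentations.exists_isGalois_fixingSubgroup_eq K
      (AlgebraicClosure K) _ _ _ _ H ‹H.Normal› hH
  refine ⟨E₀, h1, h2, ?_⟩
  unfold galFixing
  rw [h3]
  exact Subgroup.ext fun _ => Iff.rfl

/-! ### The local-field case: finiteness, `|H²(H, μ_N(A))| = N`, cyclicity, `F_N(A) ≅ ℤ/Nℤ` -/

section Local

variable [ValuativeRel K] [TopologicalSpace K] [IsNonarchimedeanLocalField K] [CharZero K]
variable [NeZero N]

include m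

/-- **Remark 2.2.1, input** (FrdII p. 18: "the finiteness of the cohomology modules
`H¹(H, μ_N(A))`, `H²(H, μ_N(A))` [cf., e.g., [NSW], Chapter 7, Theorem 7.2.6]"), degree 2, at the
Galois binding over a non-archimedean local field `K` of characteristic `0`.
[cite: MochizukiFrdII2008, Rmk 2.2.1 p.18] -/
theorem finite_h2_ofGalois :
    Finite (continuousCohomology 2
      (TopRep.res ((ofGalois L H hH res res_smul).qHA :
          (ofGalois L H hH res res_smul).H →* (ofGalois L H hH res res_smul).HA)
        (Kummer.muTopRep N O (ofGalois L H hH res res_smul).HA))) := by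
  obtain ⟨E₀, hfin, _, hE⟩ := exists_galFixing_eq H hH
  subst hE
  haveI := hfin
  haveI := finite_two_mu K E₀ N
  exact Finite.of_equiv _ (cohomologyEquiv_ofGalois L O (galFixing K E₀) hH res res_smul m 2).toEquiv.symm

/-- **Remark 2.2.1, input**, degree 1: `H¹(H, μ_N(A))` is finite (Shapiro + finiteness of `H¹` of
a finite module over a local field, the tree's `finite_continuousCohomology_one_restrict`).
[cite: MochizukiFrdII2008, Rmk 2.2.1 p.18] -/
theorem finite_h1_ofGalois :
    Finite (continuousCohomology 1
      (TopRep.res ((ofGalois L H hH res res_smul).qHA :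
          (ofGalois L H hH res res_smul).H →* (ofGalois L H hH res res_smul).HA)
        (Kummer.muTopRep N O (ofGalois L H hH res res_smul).HA))) := by
  haveI : IsClosed (H : Set (absoluteGaloisGroup K)) := OpenSubgroup.isClosed ⟨H, hH⟩
  haveI : Finite (absoluteGaloisGroup K ⧸ H) := Subgroup.quotient_finite_of_isOpen H hH
  haveI : Finite (MuCarrier K N) := finite_muCarrier K N
  haveI := finite_continuousCohomology_one_restrict K H (mu K N)
  exact Finite.of_equiv _ (cohomologyEquiv_ofGalois L O H hH res res_smul m 1).toEquiv.symm

/-- **"`F_N(A) ≅ H²(H, μ_N(A)) ≅ ℤ/Nℤ`", the order**: `|H²(H, μ_N(A))| = N` at the Galois binding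
(`H = Gal(K̄/E₀)`, the tree's `natCard_two_mu_eq`: Brauer group of the local field `E₀`).
[cite: MochizukiFrdII2008, Def 2.2 (ii) p.18] -/
theorem natCard_h2_ofGalois :
    Nat.card (continuousCohomology 2
      (TopRep.res ((ofGalois L H hH res res_smul).qHA :
          (ofGalois L H hH res res_smul).H →* (ofGalois L H hH res res_smul).HA)
        (Kummer.muTopRep N O (ofGalois L H hH res res_smul).HA))) = N := by
  obtain ⟨E₀, hfin, _, hE⟩ := exists_galFixing_eq H hH
  subst hE
  haveI := hfin
  rw [Nat.card_congr (cohomologyEquiv_ofGalois L O (galFixing K E₀) hH res res_smul m 2).toEquiv]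
  exact natCard_two_mu_eq K E₀ N

/-- `H²(H, μ_N(A))` is cyclic at the Galois binding. [cite: MochizukiFrdII2008, Def 2.2 (ii) p.18] -/
theorem isAddCyclic_h2_ofGalois :
    IsAddCyclic (continuousCohomology 2
      (TopRep.res ((ofGalois L H hH res res_smul).qHA :
          (ofGalois L H hH res res_smul).H →* (ofGalois L H hH res res_smul).HA)
        (Kummer.muTopRep N O (ofGalois L H hH res res_smul).HA))) := by
  obtain ⟨E₀, hfin, _, hE⟩ := exists_galFixing_eq H hH
  subst hE
  haveI := hfin
  haveI := isAddCyclic_two_mu K E₀ N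
  exact isAddCyclic_of_injective
    (cohomologyEquiv_ofGalois L O (galFixing K E₀) hH res res_smul m 2).toAddMonoidHom
    (cohomologyEquiv_ofGalois L O (galFixing K E₀) hH res res_smul m 2).injective

end Local

/-! ### `F_N(A) ≅ ℤ/Nℤ` -/

/-- Abstract form, for ANY context `X` (no arithmetic): if `H²(H, μ_N(A))` is cyclic of order `N`
and the map `H²(H_A, μ_N(A)) → H²(H, μ_N(A))` of Def. 2.2 (ii)(c) is surjective, then
`F_N(A) ≅ H²(H, μ_N(A)) ≅ ℤ/Nℤ` (`Kummer.fnEquivOfSurjective` + the cyclic-group isomorphism).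
[cite: MochizukiFrdII2008, Def 2.2 (ii) p.18] -/
theorem _root_.Literature.AlgebraicGeometry.Frobenioids.PadicKummer.fnIsCyclic_of_isAddCyclic
    (X : Def22Context) (N : ℕ) [NeZero N]
    (hcyc : IsAddCyclic (continuousCohomology 2
      (TopRep.res (X.qHA : X.H →* X.HA) (Kummer.muTopRep N X.O X.HA))))
    (hcard : Nat.card (continuousCohomology 2
      (TopRep.res (X.qHA : X.H →* X.HA) (Kummer.muTopRep N X.O X.HA))) = N)
    (hc : Function.Surjective (Kummer.infl X.HA X.qHA (Kummer.muTopRep N X.O X.HA) 2).hom) :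
    Kummer.FNIsCyclic N X.O X.HA X.qHA :=
  ⟨(Kummer.fnEquivOfSurjective N X.O X.HA X.qHA hc).trans
    ((zmodAddCyclicAddEquiv hcyc).symm.trans (ZMod.ringEquivCongr hcard).toAddEquiv)⟩

/-- Abstract form from `(N, H)`-saturation (Def. 2.2 (ii)(c) includes the surjectivity clause).
[cite: MochizukiFrdII2008, Def 2.2 (ii) p.18] -/
theorem _root_.Literature.AlgebraicGeometry.Frobenioids.PadicKummer.fnIsCyclic_of_isNHSaturated
    (X : Def22Context) (N : ℕ) [NeZero N]
    (hcyc : IsAddCyclic (continuousCohomology 2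
      (TopRep.res (X.qHA : X.H →* X.HA) (Kummer.muTopRep N X.O X.HA))))
    (hcard : Nat.card (continuousCohomology 2
      (TopRep.res (X.qHA : X.H →* X.HA) (Kummer.muTopRep N X.O X.HA))) = N)
    (h : IsNHSaturated X N) : Kummer.FNIsCyclic N X.O X.HA X.qHA :=
  fnIsCyclic_of_isAddCyclic X N hcyc hcard h.cohSaturated.surjective_two_mu

section Local

variable [ValuativeRel K] [TopologicalSpace K] [IsNonarchimedeanLocalField K] [CharZero K]
variable [NeZero N]

include m in
/-- **`Kummer.FNIsCyclic` DISCHARGED at the Galois binding** (FrdII Def. 2.2 (ii), p. 18: "— so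
`F_N(A) ≅ H²(H, μ_N(A)) ≅ ℤ/Nℤ` [cf., e.g., [NSW], Chapter 7, Theorem 7.2.6]"): for a
non-archimedean local field `K` of characteristic `0`, `N ≥ 1`, the context
`X = Def22Context.ofGalois L H …`, a `G_K`-equivariant identification `μ_N(A) ≅ μ_N(K̄)` and an
`(N, H)`-saturated `A` (only the surjectivity clause of (c) is used), `F_N(A) ≃+ ℤ/Nℤ` — stated
through the wrapper `PadicKummer.FN X N` (definitionally `Kummer.FNIsCyclic N X.O X.HA X.qHA`;
see the note on topologies in the module header). [cite: MochizukiFrdII2008, Def 2.2 (ii) p.18] -/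
theorem nonempty_fn_equiv_zmod_ofGalois (h : IsNHSaturated (ofGalois L H hH res res_smul) N) :
    Nonempty (FN (ofGalois L H hH res res_smul) N ≃+ ZMod N) :=
  fnIsCyclic_of_isNHSaturated (ofGalois L H hH res res_smul) N
    (isAddCyclic_h2_ofGalois L O H hH res res_smul m)
    (natCard_h2_ofGalois L O H hH res res_smul m) h

end Local

end Def22Context

end PadicKummer

end Literature.AlgebraicGeometry.Frobenioids

end
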